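import Mathlib
import HarnessLib
import Summits.Ventures.LatticeQCDFlow.Exactness.Phi4HMCFluctuationRelation
import Summits.Ventures.LatticeQCDFlow.Exactness.InvolutiveMetropolisEnergyBound
import Summits.Ventures.LatticeQCDFlow.Exactness.SU2MultiStepLeapfrogHMC
import Summits.Ventures.LatticeQCDFlow.Exactness.U1MultiStepLeapfrogHMC
import Literature.MathematicalPhysics.QuantumFieldTheory.Balaban1983to89.Beta.TransportVertices

/-!
# Creutz's second-order relation `⟨ΔH⟩ = ½⟨ΔH²⟩ + third order`, with its remainder, for every exact proposal — and on the engine's rungs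

HONEST FRAMING: exact (Metropolis-corrected) sampling algorithms for lattice gauge theory;
figures of merit are autocorrelation/cost numbers at stated couplings and volumes; no
continuum-physics claim.

Venture `LatticeQCDFlow` (cell pub-lqcd), topic `Exactness`; FANOUT row 14 (`eng-flowhmc`: the
learned-map-inside-HMC engine `latflow-fthmc`, accepted on `⟨e^{−ΔH}⟩ = 1 within 2σ over 10⁴
trajectories` and a reversibility test).  NEW WORK of the cell over Mathlib and the tree; nothing is
cited as a fact.  Printed counterparts, named only: Creutz 1988 (the identity `⟨e^{−ΔH}⟩ = 1` and its
small-`ΔH` consequence `⟨ΔH⟩ ≈ ½⟨ΔH²⟩`), Gupta–Irbäck–Karsch–Petersson 1990 (the `ΔH` statistics of HMC).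

`Phi4HMCFluctuationRelation.lean` typed the whole fluctuation relation of `ΔH = H∘Ψ − H` under `e^{−H}`
for a measure-preserving involution `Ψ` (`creutz_integral`: `∫ e^{−ΔH} e^{−H} = ∫ e^{−H}`), and
`GaugeFTHMCJensen.lean` its first-order consequence `⟨ΔH⟩ ≥ 0`.  The battery's `dH` column is read in
practice through the SECOND-order consequence — the mean violation is half the mean-square violation
up to third order — which is what makes `⟨ΔH⟩` (cheap, low variance) a proxy for the acceptance.  This
file types that consequence as an INEQUALITY WITH AN EXPLICIT REMAINDER, valid at every step size, for
every exact proposal, and instantiates it on both rungs of the engine.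

## What is proved (def-free)

* §1 `abs_exp_neg_sub_quadratic_le` — the cubic Taylor remainder `|e^{−x} − (1 − x + x²/2)| ≤
  (|x|³/6) e^{|x|}` for every real `x` (Mathlib's `Complex.norm_exp_sub_sum_le_exp_norm_sub_sum` and
  the tree's real tail bound `Beta.TransportVertices.expTail_three_le`, used BY NAME, not restated).
* §2 (measure space `(X, μ)`, `Ψ` a measurable `μ`-preserving involution, `H` with `e^{−H}` integrable,
  `ΔH = deltaH H Ψ`).  **`abs_integral_deltaH_sub_half_sq_le`** — if `ΔH e^{−H}`, `ΔH² e^{−H}` and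
  `|ΔH|³ e^{|ΔH|} e^{−H}` are integrable then
  `|∫ ΔH e^{−H} dμ − ½ ∫ ΔH² e^{−H} dμ| ≤ (1/6) ∫ |ΔH|³ e^{|ΔH|} e^{−H} dμ`;
  `abs_mean_deltaH_sub_half_sq_le` — the same divided by `Z = ∫ e^{−H} > 0`
  (`|⟨ΔH⟩ − ½⟨ΔH²⟩| ≤ (1/6)⟨|ΔH|³ e^{|ΔH|}⟩`); **`abs_integral_deltaH_sub_half_sq_le_of_abs_le`** — if
  `|ΔH| ≤ δ` everywhere, all three moments exist and `|∫ ΔH e^{−H} − ½ ∫ ΔH² e^{−H}| ≤ (δe^{δ}/6) ∫ ΔH² e^{−H}`,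
  i.e. `⟨ΔH⟩ = ½⟨ΔH²⟩·(1 + O(δ))`.
* §3 `su2LeapfrogProposalN_deltaH_second_order` — the `SU(2)` rung as the engine runs it: product-Haar
  links, Pauli momenta `ι → ℝ³` with `T_κ = κ Σ‖p_l‖²` (`κ > 0`), ANY measurable action `S` with `e^{−S}`
  integrable (the Wilson action, or a pulled-back FT action `S∘F − log J` of a certified layer), ANY
  measurable force `g`, any `ε`, any `nstep = n`, `Ψ = sunLeapfrogProposalN pauliCoordι … ε g n`: the §2
  inequality for `H = S + T_κ` over `Haar^{⊗ι} ⊗ Lebesgue`, given the three moments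
  (with `integrable_exp_neg_su2Kinetic`, `integrable_exp_neg_su2Hamiltonian`).
* §4 `u1LeapfrogProposalN_deltaH_second_order` — the same on the `U(1)` rung
  (`Ψ = u1LeapfrogProposalN ε g n`, `T_κ = κ Σ p_l²`).

Reading for the battery (no new numerics implied): with `ΔH = O(ε²)` per trajectory (the pointwise
laws of `SU2LeapfrogEnergyError.lean` / `U1LeapfrogEnergyError.lean`) both `⟨ΔH⟩` and `½⟨ΔH²⟩` are
`O(ε⁴)` while their difference is `O(ε⁶)`; a measured `⟨ΔH⟩/⟨ΔH²⟩` far from `½` at small `ε` therefore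
signals a non-exact kernel (irreversibility, a force/action mismatch, or precision loss), exactly like
a failed `⟨e^{−ΔH}⟩ = 1`.  NOT CLAIMED: finiteness of the exponential moment `⟨|ΔH|³e^{|ΔH|}⟩` for the
engine's Gaussian momenta (an assumption of §3–§4; it holds e.g. for bounded `ΔH`, §2), any statement
at fixed floating-point precision, OMF words (the §2 lemma applies verbatim to any measure-preserving
involution, in particular to `flip ∘ omf2Wordⁿ` of `GaugeFTHMCSymmetricWord.lean`).
-/

noncomputable section

namespace Summit.Ventures.LatticeQCDFlow.Exactness

open Real Set Function MeasureTheory Filter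
open Literature.MathematicalPhysics.QuantumFieldTheory
open Literature.MathematicalPhysics.QuantumFieldTheory.Balaban1983to89.Beta.TransportVertices (expTail_three expTail_three_le)
open scoped ENNReal

set_option backward.isDefEq.respectTransparency false

/-! ## §1 The cubic Taylor remainder of `e^{−x}` -/

/-- **The cubic Taylor remainder of `e^{−x}`**: `|e^{−x} − (1 − x + x²/2)| ≤ (|x|³/6)·e^{|x|}` for every
real `x`. -/
theorem abs_exp_neg_sub_quadratic_le (x : ℝ) :
    |Real.exp (-x) - (1 - x + x ^ 2 / 2)| ≤ |x| ^ 3 / 6 * Real.exp |x| := by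
  have h := Complex.norm_exp_sub_sum_le_exp_norm_sub_sum ((-x : ℝ) : ℂ) 3
  have hs : ∑ m ∈ Finset.range 3, ((-x : ℝ) : ℂ) ^ m / (m.factorial : ℂ)
      = (((1 - x + x ^ 2 / 2) : ℝ) : ℂ) := by
    simp only [Finset.sum_range_succ, Finset.sum_range_zero, Nat.factorial, pow_zero, pow_one,
      Nat.cast_one, zero_add]
    push_cast
    ring
  have hn : ‖((-x : ℝ) : ℂ)‖ = |x| := by rw [Complex.norm_real, Real.norm_eq_abs, abs_neg]
  rw [hs, ← Complex.ofReal_exp, ← Complex.ofReal_sub, Complex.norm_real, Real.norm_eq_abs, hn] at h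
  have hs' : ∑ m ∈ Finset.range 3, |x| ^ m / (m.factorial : ℝ) = 1 + |x| + |x| ^ 2 / 2 := by
    simp only [Finset.sum_range_succ, Finset.sum_range_zero, Nat.factorial, pow_zero, pow_one,
      Nat.cast_one, zero_add]
    norm_num
  rw [hs'] at h
  have h3 := expTail_three_le (abs_nonneg x)
  rw [expTail_three] at h3
  linarith

/-! ## §2 `⟨ΔH⟩ = ½⟨ΔH²⟩` up to third order, for every measure-preserving involution -/

section General

variable {X : Type*} [MeasurableSpace X] {μ : Measure X}

/-- **CREUTZ'S SECOND-ORDER RELATION, with its remainder.**  For a measurable `μ`-preserving involution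
`Ψ`, a measurable `H` with `e^{−H}` integrable, and the energy violation `ΔH = H∘Ψ − H`: if the moments
`ΔH e^{−H}`, `ΔH² e^{−H}` and `|ΔH|³ e^{|ΔH|} e^{−H}` are integrable, then
`|∫ ΔH e^{−H} dμ − ½ ∫ ΔH² e^{−H} dμ| ≤ (1/6) ∫ |ΔH|³ e^{|ΔH|} e^{−H} dμ`.
(Expand `e^{−ΔH}` to second order inside Creutz's identity `∫ e^{−ΔH} e^{−H} = ∫ e^{−H}`.) -/
theorem abs_integral_deltaH_sub_half_sq_le {H : X → ℝ} {Ψ : X → X} (hΨm : Measurable Ψ)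
    (hΨi : Function.Involutive Ψ) (hΨμ : MeasurePreserving Ψ μ μ)
    (h0 : Integrable (fun z => Real.exp (-H z)) μ)
    (h1 : Integrable (fun z => deltaH H Ψ z * Real.exp (-H z)) μ)
    (h2 : Integrable (fun z => deltaH H Ψ z ^ 2 * Real.exp (-H z)) μ)
    (h3 : Integrable (fun z => |deltaH H Ψ z| ^ 3 * Real.exp |deltaH H Ψ z| * Real.exp (-H z)) μ) :
    |∫ z, deltaH H Ψ z * Real.exp (-H z) ∂μ - 1 / 2 * ∫ z, deltaH H Ψ z ^ 2 * Real.exp (-H z) ∂μ|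
      ≤ 1 / 6 * ∫ z, |deltaH H Ψ z| ^ 3 * Real.exp |deltaH H Ψ z| * Real.exp (-H z) ∂μ := by
  have hE : Integrable (fun z => Real.exp (-deltaH H Ψ z) * Real.exp (-H z)) μ :=
    integrable_exp_neg_deltaH_mul hΨμ h0
  have hC : ∫ z, Real.exp (-deltaH H Ψ z) * Real.exp (-H z) ∂μ = ∫ z, Real.exp (-H z) ∂μ :=
    creutz_integral hΨm hΨi hΨμ
  -- the second-order Taylor defect, weighted
  have hφ : ∫ z, (Real.exp (-deltaH H Ψ z) - (1 - deltaH H Ψ z + deltaH H Ψ z ^ 2 / 2)) * Real.exp (-H z) ∂μ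
      = ∫ z, deltaH H Ψ z * Real.exp (-H z) ∂μ - 1 / 2 * ∫ z, deltaH H Ψ z ^ 2 * Real.exp (-H z) ∂μ := by
    have hsplit : ∀ z, (Real.exp (-deltaH H Ψ z) - (1 - deltaH H Ψ z + deltaH H Ψ z ^ 2 / 2)) * Real.exp (-H z)
        = (Real.exp (-deltaH H Ψ z) * Real.exp (-H z) - Real.exp (-H z))
          + (deltaH H Ψ z * Real.exp (-H z) - 1 / 2 * (deltaH H Ψ z ^ 2 * Real.exp (-H z))) := by
      intro z; ring
    simp_rw [hsplit]
    have hA : Integrable (fun z => Real.exp (-deltaH H Ψ z) * Real.exp (-H z) - Real.exp (-H z)) μ := hE.sub h0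
    have hB : Integrable (fun z => deltaH H Ψ z * Real.exp (-H z) - 1 / 2 * (deltaH H Ψ z ^ 2 * Real.exp (-H z))) μ :=
      h1.sub (h2.const_mul _)
    rw [integral_add hA hB, integral_sub hE h0, integral_sub h1 (h2.const_mul _), integral_const_mul, hC, sub_self,
      zero_add]
  rw [← hφ, ← integral_const_mul]
  refine (abs_integral_le_integral_abs).trans (integral_mono_of_nonneg (Eventually.of_forall fun z => abs_nonneg _)
    (h3.const_mul _) (Eventually.of_forall fun z => ?_))
  simp only
  rw [abs_mul, abs_of_pos (Real.exp_pos (-H z))]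
  have h := abs_exp_neg_sub_quadratic_le (deltaH H Ψ z)
  have hpos := Real.exp_pos (-H z)
  nlinarith

/-- **Normalised form**: with `Z = ∫ e^{−H} dμ > 0` and `⟨f⟩ = Z⁻¹ ∫ f e^{−H} dμ`,
`|⟨ΔH⟩ − ½⟨ΔH²⟩| ≤ (1/6)⟨|ΔH|³ e^{|ΔH|}⟩`. -/
theorem abs_mean_deltaH_sub_half_sq_le {H : X → ℝ} {Ψ : X → X} (hΨm : Measurable Ψ)
    (hΨi : Function.Involutive Ψ) (hΨμ : MeasurePreserving Ψ μ μ)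
    (h0 : Integrable (fun z => Real.exp (-H z)) μ)
    (h1 : Integrable (fun z => deltaH H Ψ z * Real.exp (-H z)) μ)
    (h2 : Integrable (fun z => deltaH H Ψ z ^ 2 * Real.exp (-H z)) μ)
    (h3 : Integrable (fun z => |deltaH H Ψ z| ^ 3 * Real.exp |deltaH H Ψ z| * Real.exp (-H z)) μ)
    (hZ : 0 < ∫ z, Real.exp (-H z) ∂μ) :
    |(∫ z, deltaH H Ψ z * Real.exp (-H z) ∂μ) / (∫ z, Real.exp (-H z) ∂μ)
        - 1 / 2 * ((∫ z, deltaH H Ψ z ^ 2 * Real.exp (-H z) ∂μ) / (∫ z, Real.exp (-H z) ∂μ))|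
      ≤ 1 / 6 * ((∫ z, |deltaH H Ψ z| ^ 3 * Real.exp |deltaH H Ψ z| * Real.exp (-H z) ∂μ)
          / (∫ z, Real.exp (-H z) ∂μ)) := by
  have h := abs_integral_deltaH_sub_half_sq_le hΨm hΨi hΨμ h0 h1 h2 h3
  rw [mul_div_assoc', ← sub_div, abs_div, abs_of_pos hZ, mul_div_assoc']
  exact div_le_div_of_nonneg_right h hZ.le

/-- **Bounded violation**: if `|ΔH| ≤ δ` everywhere then (all moments exist and)
`|∫ ΔH e^{−H} − ½ ∫ ΔH² e^{−H}| ≤ (δ e^{δ}/6) ∫ ΔH² e^{−H}` — i.e. `⟨ΔH⟩ = ½⟨ΔH²⟩(1 + O(δ))`. -/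
theorem abs_integral_deltaH_sub_half_sq_le_of_abs_le {H : X → ℝ} {Ψ : X → X} (hH : Measurable H)
    (hΨm : Measurable Ψ) (hΨi : Function.Involutive Ψ) (hΨμ : MeasurePreserving Ψ μ μ)
    (h0 : Integrable (fun z => Real.exp (-H z)) μ) {δ : ℝ} (hδ : ∀ z, |deltaH H Ψ z| ≤ δ) :
    |∫ z, deltaH H Ψ z * Real.exp (-H z) ∂μ - 1 / 2 * ∫ z, deltaH H Ψ z ^ 2 * Real.exp (-H z) ∂μ|
      ≤ δ * Real.exp δ / 6 * ∫ z, deltaH H Ψ z ^ 2 * Real.exp (-H z) ∂μ := by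
  have hDm : Measurable (deltaH H Ψ) := measurable_deltaH hH hΨm
  -- every `f(ΔH) e^{−H}` with `f` continuous is integrable: `f(ΔH)` is bounded on `[−δ, δ]`
  have hint : ∀ {f : ℝ → ℝ}, Continuous f → Integrable (fun z => f (deltaH H Ψ z) * Real.exp (-H z)) μ := by
    intro f hf
    obtain ⟨C, hC⟩ := (isCompact_Icc (a := -δ) (b := δ)).exists_bound_of_continuousOn hf.continuousOn
    refine h0.bdd_mul (hf.measurable.comp hDm).aestronglyMeasurable (c := C) (Eventually.of_forall fun z => ?_)
    exact hC _ (Set.mem_Icc.2 (abs_le.1 (hδ z)))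
  have h1 : Integrable (fun z => deltaH H Ψ z * Real.exp (-H z)) μ := hint continuous_id
  have h2 : Integrable (fun z => deltaH H Ψ z ^ 2 * Real.exp (-H z)) μ := hint (continuous_pow 2)
  have h3 : Integrable (fun z => |deltaH H Ψ z| ^ 3 * Real.exp |deltaH H Ψ z| * Real.exp (-H z)) μ :=
    hint ((continuous_abs.pow 3).mul (Real.continuous_exp.comp continuous_abs))
  refine (abs_integral_deltaH_sub_half_sq_le hΨm hΨi hΨμ h0 h1 h2 h3).trans ?_
  rw [mul_comm (δ * Real.exp δ / 6), ← integral_mul_const, ← integral_const_mul]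
  refine integral_mono (h3.const_mul _) (h2.mul_const _) fun z => ?_
  simp only
  have ha := hδ z
  have hD0 := abs_nonneg (deltaH H Ψ z)
  have hδ0 : 0 ≤ δ := hD0.trans ha
  have hsq : deltaH H Ψ z ^ 2 = |deltaH H Ψ z| ^ 2 := (sq_abs _).symm
  rw [hsq]
  have he : Real.exp |deltaH H Ψ z| ≤ Real.exp δ := Real.exp_le_exp.2 ha
  have hw := Real.exp_pos (-H z)
  have he0 := Real.exp_pos |deltaH H Ψ z|
  calc 1 / 6 * (|deltaH H Ψ z| ^ 3 * Real.exp |deltaH H Ψ z| * Real.exp (-H z))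
      = |deltaH H Ψ z| ^ 2 * Real.exp (-H z) * (|deltaH H Ψ z| * Real.exp |deltaH H Ψ z| / 6) := by ring
    _ ≤ |deltaH H Ψ z| ^ 2 * Real.exp (-H z) * (δ * Real.exp δ / 6) := by
      gcongr

end General

/-! ## §3 The `SU(2)` rung: the engine's `n`-step Pauli-drift leapfrog proposal -/

section SU2

variable {ι : Type*} [Fintype ι]

/-- `e^{−T_κ}` is Lebesgue-integrable on the `SU(2)` momenta (`κ > 0`). -/
theorem integrable_exp_neg_su2Kinetic {κ : ℝ} (hκ : 0 < κ) :
    Integrable (fun p : ι → EuclideanSpace ℝ (Fin 3) => Real.exp (-su2Kinetic κ p))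
      (Measure.pi fun _ : ι => (volume : Measure (EuclideanSpace ℝ (Fin 3)))) := by
  refine ⟨(measurable_su2Kinetic κ).neg.exp.aestronglyMeasurable,
    (hasFiniteIntegral_iff_ofReal (ae_of_all _ fun p => (Real.exp_pos _).le)).2 ?_⟩
  have h := su2MomentumWeight_univ_ne_top (ι := ι) hκ
  rw [su2MomentumWeight, withDensity_apply _ MeasurableSet.univ, Measure.restrict_univ] at h
  exact h.lt_top

/-- `e^{−H}`, `H(q,p) = S(q) + T_κ(p)`, is integrable on `Haar^{⊗ι} ⊗ Lebesgue` when `e^{−S}` is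
Haar-integrable and `κ > 0`. -/
theorem integrable_exp_neg_su2Hamiltonian {S : (ι → Matrix.specialUnitaryGroup (Fin 2) ℂ) → ℝ}
    (hSi : Integrable (fun q => Real.exp (-S q))
      (Measure.pi fun _ : ι => haarProbability (Matrix.specialUnitaryGroup (Fin 2) ℂ)))
    {κ : ℝ} (hκ : 0 < κ) :
    Integrable (fun z : (ι → Matrix.specialUnitaryGroup (Fin 2) ℂ) × (ι → EuclideanSpace ℝ (Fin 3)) =>
        Real.exp (-(S z.1 + su2Kinetic κ z.2)))
      ((Measure.pi fun _ : ι => haarProbability (Matrix.specialUnitaryGroup (Fin 2) ℂ)).prod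
        (Measure.pi fun _ : ι => (volume : Measure (EuclideanSpace ℝ (Fin 3))))) := by
  refine (hSi.mul_prod (integrable_exp_neg_su2Kinetic (ι := ι) hκ)).congr (ae_of_all _ fun z => ?_)
  simp only
  rw [neg_add, Real.exp_add]

/-- **CREUTZ'S SECOND-ORDER RELATION ON THE `SU(2)` RUNG.**  Product-Haar links, Pauli momenta with the
kinetic term `T_κ = κ Σ‖p_l‖²` (`κ > 0`), ANY measurable action `S` with `e^{−S}` integrable, ANY measurable
force `g`, any step `ε` and any `nstep = n`: for the engine's proposal `Ψ = sunLeapfrogProposalN … ε g n`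
(flip ∘ leapfrogⁿ, a `Haar ⊗ Lebesgue`-preserving involution) and `ΔH = H∘Ψ − H`, `H = S + T_κ`, whenever the
three moments exist,
`|∫ ΔH e^{−H} − ½ ∫ ΔH² e^{−H}| ≤ (1/6) ∫ |ΔH|³ e^{|ΔH|} e^{−H}` (integrals over `Haar^{⊗ι} ⊗ Lebesgue`). -/
theorem su2LeapfrogProposalN_deltaH_second_order {S : (ι → Matrix.specialUnitaryGroup (Fin 2) ℂ) → ℝ}
    (hSi : Integrable (fun q => Real.exp (-S q))
      (Measure.pi fun _ : ι => haarProbability (Matrix.specialUnitaryGroup (Fin 2) ℂ)))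
    {κ : ℝ} (hκ : 0 < κ) (ε : ℝ)
    {g : (ι → Matrix.specialUnitaryGroup (Fin 2) ℂ) → ι → EuclideanSpace ℝ (Fin 3)} (hg : Measurable g) (n : ℕ)
    (h1 : Integrable (fun z => deltaH (fun z => S z.1 + su2Kinetic κ z.2)
        (⇑(sunLeapfrogProposalN pauliCoordι pauliCoordι_skew ε g n)) z * Real.exp (-(S z.1 + su2Kinetic κ z.2)))
      ((Measure.pi fun _ : ι => haarProbability (Matrix.specialUnitaryGroup (Fin 2) ℂ)).prod
        (Measure.pi fun _ : ι => (volume : Measure (EuclideanSpace ℝ (Fin 3))))))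
    (h2 : Integrable (fun z => deltaH (fun z => S z.1 + su2Kinetic κ z.2)
        (⇑(sunLeapfrogProposalN pauliCoordι pauliCoordι_skew ε g n)) z ^ 2 * Real.exp (-(S z.1 + su2Kinetic κ z.2)))
      ((Measure.pi fun _ : ι => haarProbability (Matrix.specialUnitaryGroup (Fin 2) ℂ)).prod
        (Measure.pi fun _ : ι => (volume : Measure (EuclideanSpace ℝ (Fin 3))))))
    (h3 : Integrable (fun z => |deltaH (fun z => S z.1 + su2Kinetic κ z.2)
        (⇑(sunLeapfrogProposalN pauliCoordι pauliCoordι_skew ε g n)) z| ^ 3 *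
        Real.exp |deltaH (fun z => S z.1 + su2Kinetic κ z.2) (⇑(sunLeapfrogProposalN pauliCoordι pauliCoordι_skew ε g n)) z| *
        Real.exp (-(S z.1 + su2Kinetic κ z.2)))
      ((Measure.pi fun _ : ι => haarProbability (Matrix.specialUnitaryGroup (Fin 2) ℂ)).prod
        (Measure.pi fun _ : ι => (volume : Measure (EuclideanSpace ℝ (Fin 3)))))) :
    |∫ z, deltaH (fun z => S z.1 + su2Kinetic κ z.2) (⇑(sunLeapfrogProposalN pauliCoordι pauliCoordι_skew ε g n)) z *
          Real.exp (-(S z.1 + su2Kinetic κ z.2))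
        ∂((Measure.pi fun _ : ι => haarProbability (Matrix.specialUnitaryGroup (Fin 2) ℂ)).prod
          (Measure.pi fun _ : ι => (volume : Measure (EuclideanSpace ℝ (Fin 3)))))
      - 1 / 2 * ∫ z, deltaH (fun z => S z.1 + su2Kinetic κ z.2) (⇑(sunLeapfrogProposalN pauliCoordι pauliCoordι_skew ε g n)) z ^ 2 *
          Real.exp (-(S z.1 + su2Kinetic κ z.2))
        ∂((Measure.pi fun _ : ι => haarProbability (Matrix.specialUnitaryGroup (Fin 2) ℂ)).prod
          (Measure.pi fun _ : ι => (volume : Measure (EuclideanSpace ℝ (Fin 3)))))|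
      ≤ 1 / 6 * ∫ z, |deltaH (fun z => S z.1 + su2Kinetic κ z.2) (⇑(sunLeapfrogProposalN pauliCoordι pauliCoordι_skew ε g n)) z| ^ 3 *
          Real.exp |deltaH (fun z => S z.1 + su2Kinetic κ z.2) (⇑(sunLeapfrogProposalN pauliCoordι pauliCoordι_skew ε g n)) z| *
          Real.exp (-(S z.1 + su2Kinetic κ z.2))
        ∂((Measure.pi fun _ : ι => haarProbability (Matrix.specialUnitaryGroup (Fin 2) ℂ)).prod
          (Measure.pi fun _ : ι => (volume : Measure (EuclideanSpace ℝ (Fin 3))))) :=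
  abs_integral_deltaH_sub_half_sq_le
    (μ := (Measure.pi fun _ : ι => haarProbability (Matrix.specialUnitaryGroup (Fin 2) ℂ)).prod
      (Measure.pi fun _ : ι => (volume : Measure (EuclideanSpace ℝ (Fin 3)))))
    (H := fun z : (ι → Matrix.specialUnitaryGroup (Fin 2) ℂ) × (ι → EuclideanSpace ℝ (Fin 3)) => S z.1 + su2Kinetic κ z.2)
    (Ψ := ⇑(sunLeapfrogProposalN pauliCoordι pauliCoordι_skew ε g n))
    (measurable_sunLeapfrogProposalN pauliCoordι pauliCoordι_skew ε n hg)
    (involutive_sunLeapfrogProposalN (L := ι) pauliCoordι pauliCoordι_skew ε g n)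
    (measurePreserving_sunLeapfrogProposalN pauliCoordι pauliCoordι_skew ε n
      (volume : Measure (EuclideanSpace ℝ (Fin 3))) hg)
    (integrable_exp_neg_su2Hamiltonian hSi hκ) h1 h2 h3

end SU2

/-! ## §4 The `U(1)` rung -/

section U1

variable {ι : Type*} [Fintype ι]

/-- `e^{−T_κ}` is Lebesgue-integrable on the `U(1)` momenta (`κ > 0`). -/
theorem integrable_exp_neg_u1Kinetic {κ : ℝ} (hκ : 0 < κ) :
    Integrable (fun p : ι → ℝ => Real.exp (-u1Kinetic κ p)) (volume : Measure (ι → ℝ)) := by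
  refine ⟨(measurable_u1Kinetic κ).neg.exp.aestronglyMeasurable,
    (hasFiniteIntegral_iff_ofReal (ae_of_all _ fun p => (Real.exp_pos _).le)).2 ?_⟩
  have h := u1MomentumWeight_univ_ne_top (ι := ι) hκ
  rw [u1MomentumWeight, withDensity_apply _ MeasurableSet.univ, Measure.restrict_univ] at h
  exact h.lt_top

/-- `e^{−H}`, `H(q,p) = S(q) + T_κ(p)`, is integrable on `Haar^{⊗ι} ⊗ Lebesgue` (`U(1)` rung). -/
theorem integrable_exp_neg_u1Hamiltonian {S : (ι → Circle) → ℝ}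
    (hSi : Integrable (fun q => Real.exp (-S q)) (Measure.pi fun _ : ι => haarProbability Circle))
    {κ : ℝ} (hκ : 0 < κ) :
    Integrable (fun z : (ι → Circle) × (ι → ℝ) => Real.exp (-(S z.1 + u1Kinetic κ z.2)))
      ((Measure.pi fun _ : ι => haarProbability Circle).prod (volume : Measure (ι → ℝ))) := by
  refine (hSi.mul_prod (integrable_exp_neg_u1Kinetic (ι := ι) hκ)).congr (ae_of_all _ fun z => ?_)
  simp only
  rw [neg_add, Real.exp_add]

/-- **CREUTZ'S SECOND-ORDER RELATION ON THE `U(1)` RUNG.**  Product-Haar angles, real momenta with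
`T_κ = κ Σ p_l²` (`κ > 0`), ANY measurable `S` with `e^{−S}` integrable, ANY measurable force `g`, any `ε`, any
`nstep = n`, `Ψ = u1LeapfrogProposalN ε g n`, `H = S + T_κ`, `ΔH = H∘Ψ − H`: whenever the three moments exist,
`|∫ ΔH e^{−H} − ½ ∫ ΔH² e^{−H}| ≤ (1/6) ∫ |ΔH|³ e^{|ΔH|} e^{−H}` (integrals over `Haar^{⊗ι} ⊗ Lebesgue`). -/
theorem u1LeapfrogProposalN_deltaH_second_order {S : (ι → Circle) → ℝ}
    (hSi : Integrable (fun q => Real.exp (-S q)) (Measure.pi fun _ : ι => haarProbability Circle))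
    {κ : ℝ} (hκ : 0 < κ) (ε : ℝ) {g : (ι → Circle) → ι → ℝ} (hg : Measurable g) (n : ℕ)
    (h1 : Integrable (fun z => deltaH (fun z => S z.1 + u1Kinetic κ z.2) (⇑(u1LeapfrogProposalN ε g n)) z *
        Real.exp (-(S z.1 + u1Kinetic κ z.2)))
      ((Measure.pi fun _ : ι => haarProbability Circle).prod (volume : Measure (ι → ℝ))))
    (h2 : Integrable (fun z => deltaH (fun z => S z.1 + u1Kinetic κ z.2) (⇑(u1LeapfrogProposalN ε g n)) z ^ 2 *
        Real.exp (-(S z.1 + u1Kinetic κ z.2)))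
      ((Measure.pi fun _ : ι => haarProbability Circle).prod (volume : Measure (ι → ℝ))))
    (h3 : Integrable (fun z => |deltaH (fun z => S z.1 + u1Kinetic κ z.2) (⇑(u1LeapfrogProposalN ε g n)) z| ^ 3 *
        Real.exp |deltaH (fun z => S z.1 + u1Kinetic κ z.2) (⇑(u1LeapfrogProposalN ε g n)) z| *
        Real.exp (-(S z.1 + u1Kinetic κ z.2)))
      ((Measure.pi fun _ : ι => haarProbability Circle).prod (volume : Measure (ι → ℝ)))) :
    |∫ z, deltaH (fun z => S z.1 + u1Kinetic κ z.2) (⇑(u1LeapfrogProposalN ε g n)) z * Real.exp (-(S z.1 + u1Kinetic κ z.2))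
        ∂((Measure.pi fun _ : ι => haarProbability Circle).prod (volume : Measure (ι → ℝ)))
      - 1 / 2 * ∫ z, deltaH (fun z => S z.1 + u1Kinetic κ z.2) (⇑(u1LeapfrogProposalN ε g n)) z ^ 2 *
          Real.exp (-(S z.1 + u1Kinetic κ z.2))
        ∂((Measure.pi fun _ : ι => haarProbability Circle).prod (volume : Measure (ι → ℝ)))|
      ≤ 1 / 6 * ∫ z, |deltaH (fun z => S z.1 + u1Kinetic κ z.2) (⇑(u1LeapfrogProposalN ε g n)) z| ^ 3 *
          Real.exp |deltaH (fun z => S z.1 + u1Kinetic κ z.2) (⇑(u1LeapfrogProposalN ε g n)) z| *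
          Real.exp (-(S z.1 + u1Kinetic κ z.2))
        ∂((Measure.pi fun _ : ι => haarProbability Circle).prod (volume : Measure (ι → ℝ))) :=
  abs_integral_deltaH_sub_half_sq_le
    (μ := (Measure.pi fun _ : ι => haarProbability Circle).prod (volume : Measure (ι → ℝ)))
    (H := fun z : (ι → Circle) × (ι → ℝ) => S z.1 + u1Kinetic κ z.2) (Ψ := ⇑(u1LeapfrogProposalN ε g n))
    (measurable_u1LeapfrogProposalN ε n hg) (involutive_u1LeapfrogProposalN (g := g) ε n)
    (measurePreserving_u1LeapfrogProposalN ε n hg) (integrable_exp_neg_u1Hamiltonian hSi hκ) h1 h2 h3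

end U1

end Summit.Ventures.LatticeQCDFlow.Exactness
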